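import Summits.BirchSwinnertonDyer.BirchSwinnertonDyer.Theorems.ManinLocalTwoThreeDescentTwoExtension
import Summits.BirchSwinnertonDyer.BirchSwinnertonDyer.Theorems.ManinLocalTwoThreeCuspClasses
import HarnessLib

/-!
# E-es-37 `ShiftInvariantDescentTwo` for `j ≥ 2`, part 3: Hecke, cusps, uniqueness, and the packaged `∃!`
# (MEMO-es §25.3 (D), §25.9 (D))

Summit `BirchSwinnertonDyer`, route `ManinLocalTwoThree` (cell bsd-f2-manin), crux C2 `ManinOddAtFour` (stmt-BirchSwinnertonDyer-22967),
line `kato_shift_two` v6, stub 3 (`C₃`-image residual).  With `N = 2^jL′`, `N′ = 2^{j−1}L′`, `g = U⁻(2^{j−1}L′)` and the extension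
`Ψ` of parts 1–2 (`adLowerUnip_invariant` p607202, `exists_descentTwo_extension`, `descentTwo_shiftInvariant`):

* `descentTwo_ext`: two additive functions on `Γ₀(N′)` agreeing on `Γ₀(N)` and at `g` are equal (coset dichotomy);
* `descentTwo_isHeckeGenEigenvector`: `Ψ` is a generalised `λ`-eigenvector off `S` — `w := (T_ℓ − λ_ℓ)^e Ψ` restricts to
  `(T_ℓ − λ_ℓ)^e u = 0` (`T_ℓ` commutes with `π₁^*`, `pow_heckeUZ_sub_degeneracyPullbackZ_zero`), is `2`-shift-invariant (same lemma
  with `d = 2, 1`), hence `w(g) = w(g²) = 0` (`descentTwo_apply_lowerUnip_eq`) and `w = 0`;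
* `mapGL_smul_zero_eq_self_iff` (`γ·0 = 0 ⟺ γ₀₁ = 0`) and `descentTwo_killsCusps`: `Ψ` kills the stabilisers of `∞` and `0`;
* **`shiftInvariantDescentTwo_of_two_le`**: the body of es's `EsG12.ShiftInvariantDescentTwo p` (HOME/es/Sketch-es-g12.lean) for
  `j ≥ 2`, verbatim (`NotTrivialEisensteinAt`, `KillsCuspsZeroInfty` unfolded as in the lead's files), INCLUDING `∃!`.

The case `j = 1` (target level `L′`, the `S₃`-transfer) is the `t = 2` vertex (`…VertexTwo.lean`, p606516) and is not restated here.
No new definitions; nothing about BSD or Manin's conjecture is proved here.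

References: G. Shimura (1971) §8.3 [cite: Shimura1971, §8.3 (8.3.2)]; K. S. Brown, *Cohomology of Groups*, III.10.3
[cite: Brown1982, III.10.3]; cell memo HOME/MEMO-es.md §25.9 (D); HOME/p1/NOTES-p1-g2.md (FINAL HANDOFF).
-/

set_option autoImplicit false
set_option linter.dupNamespace false

open scoped MatrixGroups

open CongruenceSubgroup Matrix.SpecialLinearGroup Literature.NumberTheory.EllipticCurves.ModularForms
  Literature.NumberTheory.EllipticCurves.ModularForms.HidaCohomology Subgroup

namespace Summit.BirchSwinnertonDyer.BirchSwinnertonDyer.Theorems.ManinLocalTwoThree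

/-! ### A cusp lemma: `γ · 0 = 0 ⟺ γ₀₁ = 0` -/

section Cusp

/-- `g 0 = 0` iff the upper-right entry of `g ∈ SL₂(ℤ)` vanishes. [folklore] -/
theorem mapGL_smul_zero_eq_self_iff (g : SL(2, ℤ)) :
    (mapGL ℚ g : GL (Fin 2) ℚ) • ((0 : ℚ) : OnePoint ℚ) = ((0 : ℚ) : OnePoint ℚ) ↔ g 0 1 = 0 := by
  rw [OnePoint.smul_some_eq_ite]
  simp only [mul_zero, zero_add, mapGL_rat_apply]
  have hdet := det_entries g
  by_cases h11 : g 1 1 = 0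
  · rw [if_pos (by exact_mod_cast h11)]
    constructor
    · intro h; exact absurd h (OnePoint.infty_ne_coe 0)
    · intro h01
      exfalso
      rw [h11, h01, mul_zero, zero_mul, sub_zero] at hdet
      exact zero_ne_one hdet
  · rw [if_neg (by exact_mod_cast h11), OnePoint.coe_eq_coe, div_eq_zero_iff]
    constructor
    · rintro (h | h)
      · exact_mod_cast h
      · exact absurd (by exact_mod_cast h) h11
    · intro h; left; exact_mod_cast h

end Cusp

section Additive

/-- An additive function on `Γ₀(M)` is a degree-`0` cocycle (plumbing). [folklore] -/
theorem mem_cocycles_of_additive {K : Type*} [CommRing K] {M : ℕ} {Ψ : Gamma0 M → Fin 1 → K}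
    (hΨ : ∀ a b : Gamma0 M, Ψ (a * b) = Ψ a + Ψ b) : Ψ ∈ cocycles 0 M K := by
  rw [mem_cocycles_iff]
  intro γ δ
  rw [hΨ]
  simp only [act_zero_eq_id, LinearMap.id_apply]
  exact add_comm _ _

end Additive

section DescentTwo

variable {p L' j : ℕ} {K : Type} [Field K] [CharP K p] [NeZero L'] (hL' : ¬ 2 ∣ L') (hj : 2 ≤ j)
  (S : Finset ℕ) (lam : ℕ → K) (u : cocycles 0 (L' * 2 ^ j) K)
  (hS : ∀ q : ℕ, q.Prime → q ∣ p * 2 * L' → q ∈ S) (hgen : IsHeckeGenEigenvector S lam u)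
  (hshift : degeneracyPullback 0 (L' * 2 ^ j) (L' * 2 ^ j * 2) 2 K dvd_rfl (u : Gamma0 (L' * 2 ^ j) → Fin 1 → K) =
    degeneracyPullback 0 (L' * 2 ^ j) (L' * 2 ^ j * 2) 1 K (by simp) (u : Gamma0 (L' * 2 ^ j) → Fin 1 → K))
  {U : SL(2, ℤ)} (hU : (U : Matrix (Fin 2) (Fin 2) ℤ) = !![1, 0; (L' : ℤ) * 2 ^ (j - 1), 1])

include hj hU

omit [CharP K p] [NeZero L'] in
/-- **Two additive functions on `Γ₀(2^{j−1}L′)` agreeing on `Γ₀(2^jL′)` and at `g` coincide** (coset dichotomy). [folklore] -/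
theorem descentTwo_ext {Ψ₁ Ψ₂ : Gamma0 (L' * 2 ^ (j - 1)) → Fin 1 → K}
    (h1 : ∀ a b : Gamma0 (L' * 2 ^ (j - 1)), Ψ₁ (a * b) = Ψ₁ a + Ψ₁ b)
    (h2 : ∀ a b : Gamma0 (L' * 2 ^ (j - 1)), Ψ₂ (a * b) = Ψ₂ a + Ψ₂ b)
    (hres : ∀ γ : Gamma0 (L' * 2 ^ j),
      Ψ₁ ⟨(γ : SL(2, ℤ)), Gamma0_level_le L' j (by omega) γ.2⟩ = Ψ₂ ⟨(γ : SL(2, ℤ)), Gamma0_level_le L' j (by omega) γ.2⟩)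
    (hg : Ψ₁ ⟨U, lowerUnip_mem_Gamma0_half hU⟩ = Ψ₂ ⟨U, lowerUnip_mem_Gamma0_half hU⟩) : Ψ₁ = Ψ₂ := by
  funext γ
  rcases mem_or_lowerUnip_inv_mul_mem hj hU (γ : SL(2, ℤ)) γ.2 with h | h
  · exact hres ⟨_, h⟩
  · have e : γ = (⟨U, lowerUnip_mem_Gamma0_half hU⟩ : Gamma0 (L' * 2 ^ (j - 1))) *
        ⟨U⁻¹ * (γ : SL(2, ℤ)), Gamma0_level_le L' j (by omega) h⟩ := by
      apply Subtype.ext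
      show (γ : SL(2, ℤ)) = U * (U⁻¹ * (γ : SL(2, ℤ)))
      rw [mul_inv_cancel_left]
    rw [e, h1, h2, hg, hres ⟨_, h⟩]

include hshift hS hgen

omit [CharP K p] in
/-- **The extension is a generalised `λ`-eigenvector off `S`** (MEMO-es §25.9 (D), Hecke part). [cite: Shimura1971, §8.3 (8.3.2)] -/
theorem descentTwo_isHeckeGenEigenvector {Ψ : Gamma0 (L' * 2 ^ (j - 1)) → Fin 1 → K}
    (hΨmul : ∀ a b : Gamma0 (L' * 2 ^ (j - 1)), Ψ (a * b) = Ψ a + Ψ b)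
    (hΨg : Ψ ⟨U, lowerUnip_mem_Gamma0_half hU⟩ = 0)
    (hΨres : ∀ γ : Gamma0 (L' * 2 ^ j), Ψ ⟨(γ : SL(2, ℤ)), Gamma0_level_le L' j (by omega) γ.2⟩ =
      (u : Gamma0 (L' * 2 ^ j) → Fin 1 → K) γ) :
    IsHeckeGenEigenvector S lam ⟨Ψ, mem_cocycles_of_additive hΨmul⟩ := by
  classical
  have hj1 : 1 ≤ j := by omega
  haveI : NeZero (L' * 2 ^ j) := inferInstance
  haveI : NeZero (L' * 2 ^ (j - 1)) := inferInstance
  have hdiv : L' * 2 ^ (j - 1) * 1 ∣ L' * 2 ^ j := by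
    rw [mul_one]; exact Nat.mul_dvd_mul_left L' (Nat.pow_dvd_pow 2 (Nat.sub_le j 1))
  intro ℓ _ hℓ hℓS
  -- `ℓ ∤ 2^jL′`, `ℓ ∤ 2^{j-1}L′·2`
  have hℓ2 : ℓ ≠ 2 := fun e ↦ hℓS (hS ℓ hℓ (e ▸ dvd_mul_of_dvd_left (dvd_mul_left 2 p) L'))
  have hℓL' : ¬ ℓ ∣ L' := fun hd ↦ hℓS (hS ℓ hℓ (hd.mul_left _))
  have hℓpow : ∀ m : ℕ, ¬ ℓ ∣ L' * 2 ^ m := by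
    intro m hd
    rcases (Nat.Prime.dvd_mul hℓ).mp hd with h | h
    · exact hℓL' h
    · exact hℓ2 ((Nat.prime_dvd_prime_iff_eq hℓ Nat.prime_two).mp (hℓ.dvd_of_dvd_pow h))
  have hℓN : ¬ ℓ ∣ L' * 2 ^ j := hℓpow j
  have hℓN2 : ¬ ℓ ∣ L' * 2 ^ (j - 1) * 2 := by rw [mul_assoc, ← pow_succ]; exact hℓpow _
  set u' : cocycles 0 (L' * 2 ^ (j - 1)) K := ⟨Ψ, mem_cocycles_of_additive hΨmul⟩ with hu'
  -- restriction of `u'` is `u`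
  have hresZ : degeneracyPullbackZ 0 (L' * 2 ^ (j - 1)) (L' * 2 ^ j) 1 K hdiv u' = u := by
    apply Subtype.ext
    rw [coe_degeneracyPullbackZ]
    funext γ
    rw [degeneracyPullback_zero_apply]
    have e : Gamma0.degeneracyConj (L' * 2 ^ (j - 1)) (L' * 2 ^ j) 1 hdiv γ =
        ⟨(γ : SL(2, ℤ)), Gamma0_level_le L' j hj1 γ.2⟩ := Subtype.ext (Gamma0.coe_degeneracyConj_one _ γ)
    rw [e]
    exact hΨres γ
  -- shift-invariance of `u'` as cocycles
  have hshZ : degeneracyPullbackZ 0 (L' * 2 ^ (j - 1)) (L' * 2 ^ (j - 1) * 2) 2 K dvd_rfl u' =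
      degeneracyPullbackZ 0 (L' * 2 ^ (j - 1)) (L' * 2 ^ (j - 1) * 2) 1 K (by simp) u' := by
    apply Subtype.ext
    rw [coe_degeneracyPullbackZ, coe_degeneracyPullbackZ]
    exact descentTwo_shiftInvariant hj u hshift hU hΨmul hΨg hΨres
  -- the exponent killing `u`
  have hmem := hgen ℓ hℓ hℓS
  rw [Module.End.mem_maxGenEigenspace] at hmem ⊢
  obtain ⟨e, he⟩ := hmem
  refine ⟨e, ?_⟩
  set w : cocycles 0 (L' * 2 ^ (j - 1)) K :=
    ((heckeUZ 0 (L' * 2 ^ (j - 1)) K hℓ - lam ℓ • (1 : Module.End K (cocycles 0 (L' * 2 ^ (j - 1)) K))) ^ e) u'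
    with hw
  have hwmul : ∀ a b : Gamma0 (L' * 2 ^ (j - 1)), (w : Gamma0 (L' * 2 ^ (j - 1)) → Fin 1 → K) (a * b) =
      (w : Gamma0 (L' * 2 ^ (j - 1)) → Fin 1 → K) a + (w : Gamma0 (L' * 2 ^ (j - 1)) → Fin 1 → K) b :=
    cocycle_zero_mul w.2
  -- (i) `w` vanishes on `Γ₀(2^jL′)`
  have hwres : degeneracyPullbackZ 0 (L' * 2 ^ (j - 1)) (L' * 2 ^ j) 1 K hdiv w = 0 := by
    rw [hw, ← pow_heckeUZ_sub_degeneracyPullbackZ_zero hdiv hℓ hℓN (lam ℓ) e u', hresZ, he]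
  have hwN : ∀ γ : Gamma0 (L' * 2 ^ j),
      (w : Gamma0 (L' * 2 ^ (j - 1)) → Fin 1 → K) ⟨(γ : SL(2, ℤ)), Gamma0_level_le L' j hj1 γ.2⟩ = 0 := by
    intro γ
    have h := congrFun (congrArg (fun z : cocycles 0 (L' * 2 ^ j) K ↦ (z : Gamma0 (L' * 2 ^ j) → Fin 1 → K)) hwres) γ
    simp only [coe_degeneracyPullbackZ, degeneracyPullback_zero_apply, Submodule.coe_zero, Pi.zero_apply] at h
    have e1 : Gamma0.degeneracyConj (L' * 2 ^ (j - 1)) (L' * 2 ^ j) 1 hdiv γ =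
        ⟨(γ : SL(2, ℤ)), Gamma0_level_le L' j hj1 γ.2⟩ := Subtype.ext (Gamma0.coe_degeneracyConj_one _ γ)
    rw [e1] at h
    exact h
  -- (ii) `w` is shift-invariant
  have hwsh : degeneracyPullback 0 (L' * 2 ^ (j - 1)) (L' * 2 ^ (j - 1) * 2) 2 K dvd_rfl
      (w : Gamma0 (L' * 2 ^ (j - 1)) → Fin 1 → K) =
      degeneracyPullback 0 (L' * 2 ^ (j - 1)) (L' * 2 ^ (j - 1) * 2) 1 K (by simp)
      (w : Gamma0 (L' * 2 ^ (j - 1)) → Fin 1 → K) := by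
    have h := congrArg (fun z : cocycles 0 (L' * 2 ^ (j - 1) * 2) K ↦ (z : Gamma0 (L' * 2 ^ (j - 1) * 2) → Fin 1 → K))
      (show degeneracyPullbackZ 0 (L' * 2 ^ (j - 1)) (L' * 2 ^ (j - 1) * 2) 2 K dvd_rfl w =
        degeneracyPullbackZ 0 (L' * 2 ^ (j - 1)) (L' * 2 ^ (j - 1) * 2) 1 K (by simp) w by
        rw [hw, ← pow_heckeUZ_sub_degeneracyPullbackZ_zero dvd_rfl hℓ hℓN2 (lam ℓ) e u',
          ← pow_heckeUZ_sub_degeneracyPullbackZ_zero (by simp) hℓ hℓN2 (lam ℓ) e u', hshZ])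
    simpa only [coe_degeneracyPullbackZ] using h
  -- (iii) `w(g) = w(g²) = 0`
  have hwg : (w : Gamma0 (L' * 2 ^ (j - 1)) → Fin 1 → K) ⟨U, lowerUnip_mem_Gamma0_half hU⟩ = 0 := by
    rw [descentTwo_apply_lowerUnip_eq hj hU hwsh]
    exact hwN ⟨U * U, lowerUnip_sq_mem_Gamma0 hj hU⟩
  -- (iv) `w = 0`
  apply Subtype.ext
  rw [Submodule.coe_zero]
  show (w : Gamma0 (L' * 2 ^ (j - 1)) → Fin 1 → K) = 0
  refine descentTwo_ext hj hU hwmul (fun _ _ ↦ by simp) (fun γ ↦ ?_) ?_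
  · rw [hwN γ]; rfl
  · rw [hwg]; rfl

omit hS hgen hshift [CharP K p] [NeZero L']

/-- **The extension kills the stabilisers of `∞` and `0`** when `u` does: `∞`-fixers of `Γ₀(2^{j−1}L′)` lie in `Γ₀(2^jL′)`;
a `0`-fixer `γ` is lower-triangular, and either `γ ∈ Γ₀(2^jL′)` or `γ = g·(g⁻¹γ)` with `g⁻¹γ ∈ Γ₀(2^jL′)` again fixing `0`.
[cite: Shimura1971, §1.6] -/
theorem descentTwo_killsCusps {Ψ : Gamma0 (L' * 2 ^ (j - 1)) → Fin 1 → K}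
    (hΨmul : ∀ a b : Gamma0 (L' * 2 ^ (j - 1)), Ψ (a * b) = Ψ a + Ψ b)
    (hΨg : Ψ ⟨U, lowerUnip_mem_Gamma0_half hU⟩ = 0)
    (hΨres : ∀ γ : Gamma0 (L' * 2 ^ j), Ψ ⟨(γ : SL(2, ℤ)), Gamma0_level_le L' j (by omega) γ.2⟩ =
      (u : Gamma0 (L' * 2 ^ j) → Fin 1 → K) γ)
    (hcusp : (∀ γ : Gamma0 (L' * 2 ^ j), mapGL ℚ (γ : SL(2, ℤ)) • (OnePoint.infty : OnePoint ℚ) = OnePoint.infty →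
        (u : Gamma0 (L' * 2 ^ j) → Fin 1 → K) γ = 0) ∧
      (∀ γ : Gamma0 (L' * 2 ^ j), mapGL ℚ (γ : SL(2, ℤ)) • ((0 : ℚ) : OnePoint ℚ) = ((0 : ℚ) : OnePoint ℚ) →
        (u : Gamma0 (L' * 2 ^ j) → Fin 1 → K) γ = 0)) :
    (∀ γ : Gamma0 (L' * 2 ^ (j - 1)), mapGL ℚ (γ : SL(2, ℤ)) • (OnePoint.infty : OnePoint ℚ) = OnePoint.infty →
        Ψ γ = 0) ∧
      (∀ γ : Gamma0 (L' * 2 ^ (j - 1)), mapGL ℚ (γ : SL(2, ℤ)) • ((0 : ℚ) : OnePoint ℚ) = ((0 : ℚ) : OnePoint ℚ) →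
        Ψ γ = 0) := by
  have hj1 : 1 ≤ j := by omega
  constructor
  · intro γ hγ
    have h10 : (γ : SL(2, ℤ)) 1 0 = 0 := (mapGL_smul_infty_eq_self_iff _).mp hγ
    have hγN : (γ : SL(2, ℤ)) ∈ Gamma0 (L' * 2 ^ j) := mem_Gamma0_of_dvd_apply_one_zero _ (by rw [h10]; exact dvd_zero _)
    have e : γ = ⟨(γ : SL(2, ℤ)), Gamma0_level_le L' j hj1 hγN⟩ := Subtype.ext rfl
    rw [e, hΨres ⟨_, hγN⟩]
    exact hcusp.1 ⟨_, hγN⟩ hγ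
  · intro γ hγ
    have h01 : (γ : SL(2, ℤ)) 0 1 = 0 := (mapGL_smul_zero_eq_self_iff _).mp hγ
    rcases mem_or_lowerUnip_inv_mul_mem hj hU (γ : SL(2, ℤ)) γ.2 with hγN | hγN
    · have e : γ = ⟨(γ : SL(2, ℤ)), Gamma0_level_le L' j hj1 hγN⟩ := Subtype.ext rfl
      rw [e, hΨres ⟨_, hγN⟩]
      exact hcusp.2 ⟨_, hγN⟩ hγ
    · have e : γ = (⟨U, lowerUnip_mem_Gamma0_half hU⟩ : Gamma0 (L' * 2 ^ (j - 1))) *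
          ⟨U⁻¹ * (γ : SL(2, ℤ)), Gamma0_level_le L' j hj1 hγN⟩ := by
        apply Subtype.ext
        show (γ : SL(2, ℤ)) = U * (U⁻¹ * (γ : SL(2, ℤ)))
        rw [mul_inv_cancel_left]
      rw [e, hΨmul, hΨg, zero_add, hΨres ⟨_, hγN⟩]
      apply hcusp.2 ⟨_, hγN⟩
      -- `g⁻¹ γ` fixes `0`: its upper-right entry is `γ₀₁ = 0`
      rw [mapGL_smul_zero_eq_self_iff]
      show (((U⁻¹ : SL(2, ℤ)) : Matrix (Fin 2) (Fin 2) ℤ) * ((γ : SL(2, ℤ)) : Matrix (Fin 2) (Fin 2) ℤ)) 0 1 = 0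
      rw [coe_lowerUnip_inv_mul hU]
      simp only [Matrix.of_apply, Matrix.cons_val', Matrix.cons_val_zero, Matrix.cons_val_one, Matrix.empty_val',
        Matrix.cons_val_fin_one]
      exact h01

end DescentTwo

/-! ### The packaged statement: E-es-37 for `j ≥ 2` -/

section Packaged

/-- **E-es-37 `ShiftInvariantDescentTwo` for `j ≥ 2`** — the body of es's `EsG12.ShiftInvariantDescentTwo p`
(HOME/es/Sketch-es-g12.lean, `NotTrivialEisensteinAt` / `KillsCuspsZeroInfty` unfolded), restricted to `2 ≤ j`: for `L′` odd and a
`2`-shift-invariant generalised `λ`-eigen homomorphism `u` on `Γ₀(2^jL′)` killing the cusps `0, ∞`, with hNT(2), there is a UNIQUE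
`2`-shift-invariant generalised `λ`-eigen homomorphism `u′` on `Γ₀(2^{j−1}L′)` killing `0, ∞` which restricts to `u` (the extension
vanishing at `g = U⁻(2^{j−1}L′)`). [cite: Shimura1971, §8.3 (8.3.2)] -/
theorem shiftInvariantDescentTwo_of_two_le {p : ℕ} (K : Type) [Field K] [CharP K p] (L' j : ℕ) [NeZero L']
    (hL' : ¬ 2 ∣ L') (hj : 2 ≤ j) (S : Finset ℕ) (lam : ℕ → K) (u : cocycles 0 (L' * 2 ^ j) K)
    (hS : ∀ q : ℕ, q.Prime → q ∣ p * 2 * L' → q ∈ S) (hgen : IsHeckeGenEigenvector S lam u)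
    (hNT : ∀ M : ℕ, ∃ r : ℕ, r.Prime ∧ r ∉ S ∧ r ≡ 1 [MOD 2 ^ M] ∧ lam r ≠ (r : K) + 1)
    (hcusp : (∀ γ : Gamma0 (L' * 2 ^ j), mapGL ℚ (γ : SL(2, ℤ)) • (OnePoint.infty : OnePoint ℚ) = OnePoint.infty →
        (u : Gamma0 (L' * 2 ^ j) → Fin 1 → K) γ = 0) ∧
      (∀ γ : Gamma0 (L' * 2 ^ j), mapGL ℚ (γ : SL(2, ℤ)) • ((0 : ℚ) : OnePoint ℚ) = ((0 : ℚ) : OnePoint ℚ) →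
        (u : Gamma0 (L' * 2 ^ j) → Fin 1 → K) γ = 0))
    (hshift : degeneracyPullback 0 (L' * 2 ^ j) (L' * 2 ^ j * 2) 2 K dvd_rfl (u : Gamma0 (L' * 2 ^ j) → Fin 1 → K) =
      degeneracyPullback 0 (L' * 2 ^ j) (L' * 2 ^ j * 2) 1 K (by simp) (u : Gamma0 (L' * 2 ^ j) → Fin 1 → K)) :
    ∃! u' : cocycles 0 (L' * 2 ^ (j - 1)) K,
      degeneracyPullback 0 (L' * 2 ^ (j - 1)) (L' * 2 ^ j) 1 K
          (by rw [mul_one]; exact Nat.mul_dvd_mul_left L' (Nat.pow_dvd_pow 2 (Nat.sub_le j 1)))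
          (u' : Gamma0 (L' * 2 ^ (j - 1)) → Fin 1 → K) = (u : Gamma0 (L' * 2 ^ j) → Fin 1 → K) ∧
      degeneracyPullback 0 (L' * 2 ^ (j - 1)) (L' * 2 ^ (j - 1) * 2) 2 K dvd_rfl
          (u' : Gamma0 (L' * 2 ^ (j - 1)) → Fin 1 → K) =
        degeneracyPullback 0 (L' * 2 ^ (j - 1)) (L' * 2 ^ (j - 1) * 2) 1 K (by simp)
          (u' : Gamma0 (L' * 2 ^ (j - 1)) → Fin 1 → K) ∧
      IsHeckeGenEigenvector S lam u' ∧
      ((∀ γ : Gamma0 (L' * 2 ^ (j - 1)), mapGL ℚ (γ : SL(2, ℤ)) • (OnePoint.infty : OnePoint ℚ) = OnePoint.infty →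
          (u' : Gamma0 (L' * 2 ^ (j - 1)) → Fin 1 → K) γ = 0) ∧
        (∀ γ : Gamma0 (L' * 2 ^ (j - 1)), mapGL ℚ (γ : SL(2, ℤ)) • ((0 : ℚ) : OnePoint ℚ) = ((0 : ℚ) : OnePoint ℚ) →
          (u' : Gamma0 (L' * 2 ^ (j - 1)) → Fin 1 → K) γ = 0)) := by
  classical
  have hj1 : 1 ≤ j := by omega
  have hdiv : L' * 2 ^ (j - 1) * 1 ∣ L' * 2 ^ j := by
    rw [mul_one]; exact Nat.mul_dvd_mul_left L' (Nat.pow_dvd_pow 2 (Nat.sub_le j 1))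
  obtain ⟨U, hU⟩ : ∃ U : SL(2, ℤ), (U : Matrix (Fin 2) (Fin 2) ℤ) = !![1, 0; (L' : ℤ) * 2 ^ (j - 1), 1] :=
    ⟨⟨!![1, 0; (L' : ℤ) * 2 ^ (j - 1), 1], by rw [Matrix.det_fin_two_of]; ring⟩, rfl⟩
  obtain ⟨Ψ₀, hΨ₀mul, hΨ₀g, hΨ₀res⟩ := exists_descentTwo_extension hL' hj S lam u hS hgen hNT hshift hU
  set Ψ : Gamma0 (L' * 2 ^ (j - 1)) → Fin 1 → K := fun γ _ ↦ Ψ₀ γ with hΨdef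
  have hΨmul : ∀ a b : Gamma0 (L' * 2 ^ (j - 1)), Ψ (a * b) = Ψ a + Ψ b := by
    intro a b; funext i; exact hΨ₀mul a b
  have hΨg : Ψ ⟨U, lowerUnip_mem_Gamma0_half hU⟩ = 0 := by
    funext i; exact hΨ₀g
  have hΨres : ∀ γ : Gamma0 (L' * 2 ^ j), Ψ ⟨(γ : SL(2, ℤ)), Gamma0_level_le L' j hj1 γ.2⟩ =
      (u : Gamma0 (L' * 2 ^ j) → Fin 1 → K) γ := by
    intro γ
    funext i
    rw [Subsingleton.elim (α := Fin 1) i 0]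
    exact hΨ₀res γ
  -- restriction (function form)
  have hres : degeneracyPullback 0 (L' * 2 ^ (j - 1)) (L' * 2 ^ j) 1 K hdiv Ψ = (u : Gamma0 (L' * 2 ^ j) → Fin 1 → K) := by
    funext γ
    rw [degeneracyPullback_zero_apply]
    have e : Gamma0.degeneracyConj (L' * 2 ^ (j - 1)) (L' * 2 ^ j) 1 hdiv γ =
        ⟨(γ : SL(2, ℤ)), Gamma0_level_le L' j hj1 γ.2⟩ := Subtype.ext (Gamma0.coe_degeneracyConj_one _ γ)
    rw [e]
    exact hΨres γ
  refine ⟨⟨Ψ, mem_cocycles_of_additive hΨmul⟩, ⟨hres, descentTwo_shiftInvariant hj u hshift hU hΨmul hΨg hΨres,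
    descentTwo_isHeckeGenEigenvector hj S lam u hS hgen hshift hU hΨmul hΨg hΨres,
    descentTwo_killsCusps hj u hU hΨmul hΨg hΨres hcusp⟩, ?_⟩
  -- uniqueness
  rintro v ⟨hvres, hvsh, -, -⟩
  apply Subtype.ext
  show (v : Gamma0 (L' * 2 ^ (j - 1)) → Fin 1 → K) = Ψ
  have hvmul := cocycle_zero_mul v.2
  have hvres' : ∀ γ : Gamma0 (L' * 2 ^ j), (v : Gamma0 (L' * 2 ^ (j - 1)) → Fin 1 → K)
      ⟨(γ : SL(2, ℤ)), Gamma0_level_le L' j hj1 γ.2⟩ = (u : Gamma0 (L' * 2 ^ j) → Fin 1 → K) γ := by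
    intro γ
    have h := congrFun hvres γ
    rw [degeneracyPullback_zero_apply] at h
    have e : Gamma0.degeneracyConj (L' * 2 ^ (j - 1)) (L' * 2 ^ j) 1 hdiv γ =
        ⟨(γ : SL(2, ℤ)), Gamma0_level_le L' j hj1 γ.2⟩ := Subtype.ext (Gamma0.coe_degeneracyConj_one _ γ)
    rw [e] at h
    exact h
  have hvg : (v : Gamma0 (L' * 2 ^ (j - 1)) → Fin 1 → K) ⟨U, lowerUnip_mem_Gamma0_half hU⟩ = 0 := by
    rw [descentTwo_apply_lowerUnip_eq hj hU hvsh, hvres' ⟨U * U, lowerUnip_sq_mem_Gamma0 hj hU⟩]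
    exact apply_lowerUnip_sq_eq_zero hj u hshift hU
  exact descentTwo_ext hj hU hvmul hΨmul (fun γ ↦ by rw [hvres' γ, hΨres γ]) (by rw [hvg, hΨg])

/-- **E-es-37 at `p = 2`, `j ≥ 2`, in the consumer's binder shape** (p3's `h37` of `cThreeImageResidual_of_descent₂_and_facts`,
p608031): the body of `EsG12.ShiftInvariantDescentTwo 2` after `p.Prime →`, with `1 ≤ j` replaced by `2 ≤ j`.
[cite: Shimura1971, §8.3 (8.3.2)] -/
theorem shiftInvariantDescentTwo_two_of_two_le :
    ∀ (K : Type) [Field K] [CharP K 2] (L' j : ℕ) [NeZero L'], ¬ 2 ∣ L' → 2 ≤ j →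
    ∀ (S : Finset ℕ) (lam : ℕ → K) (u : cocycles 0 (L' * 2 ^ j) K),
      (∀ q : ℕ, q.Prime → q ∣ 2 * 2 * L' → q ∈ S) →
      IsHeckeGenEigenvector S lam u →
      (∀ M : ℕ, ∃ r : ℕ, r.Prime ∧ r ∉ S ∧ r ≡ 1 [MOD 2 ^ M] ∧ lam r ≠ (r : K) + 1) →
      ((∀ γ : Gamma0 (L' * 2 ^ j), mapGL ℚ (γ : SL(2, ℤ)) • (OnePoint.infty : OnePoint ℚ) = OnePoint.infty →
          (u : Gamma0 (L' * 2 ^ j) → Fin 1 → K) γ = 0) ∧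
        (∀ γ : Gamma0 (L' * 2 ^ j), mapGL ℚ (γ : SL(2, ℤ)) • ((0 : ℚ) : OnePoint ℚ) = ((0 : ℚ) : OnePoint ℚ) →
          (u : Gamma0 (L' * 2 ^ j) → Fin 1 → K) γ = 0)) →
      degeneracyPullback 0 (L' * 2 ^ j) (L' * 2 ^ j * 2) 2 K dvd_rfl (u : Gamma0 (L' * 2 ^ j) → Fin 1 → K) =
        degeneracyPullback 0 (L' * 2 ^ j) (L' * 2 ^ j * 2) 1 K (by simp) (u : Gamma0 (L' * 2 ^ j) → Fin 1 → K) →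
      ∃! u' : cocycles 0 (L' * 2 ^ (j - 1)) K,
        degeneracyPullback 0 (L' * 2 ^ (j - 1)) (L' * 2 ^ j) 1 K
            (by rw [mul_one]; exact Nat.mul_dvd_mul_left L' (Nat.pow_dvd_pow 2 (Nat.sub_le j 1)))
            (u' : Gamma0 (L' * 2 ^ (j - 1)) → Fin 1 → K) = (u : Gamma0 (L' * 2 ^ j) → Fin 1 → K) ∧
        degeneracyPullback 0 (L' * 2 ^ (j - 1)) (L' * 2 ^ (j - 1) * 2) 2 K dvd_rfl
            (u' : Gamma0 (L' * 2 ^ (j - 1)) → Fin 1 → K) =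
          degeneracyPullback 0 (L' * 2 ^ (j - 1)) (L' * 2 ^ (j - 1) * 2) 1 K (by simp)
            (u' : Gamma0 (L' * 2 ^ (j - 1)) → Fin 1 → K) ∧
        IsHeckeGenEigenvector S lam u' ∧
        ((∀ γ : Gamma0 (L' * 2 ^ (j - 1)), mapGL ℚ (γ : SL(2, ℤ)) • (OnePoint.infty : OnePoint ℚ) = OnePoint.infty →
            (u' : Gamma0 (L' * 2 ^ (j - 1)) → Fin 1 → K) γ = 0) ∧
          (∀ γ : Gamma0 (L' * 2 ^ (j - 1)), mapGL ℚ (γ : SL(2, ℤ)) • ((0 : ℚ) : OnePoint ℚ) = ((0 : ℚ) : OnePoint ℚ) →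
            (u' : Gamma0 (L' * 2 ^ (j - 1)) → Fin 1 → K) γ = 0)) :=
  fun K _ _ L' j _ hL' hj S lam u hS hgen hNT hcusp hshift ↦
    shiftInvariantDescentTwo_of_two_le (p := 2) K L' j hL' hj S lam u hS hgen hNT hcusp hshift

end Packaged

end Summit.BirchSwinnertonDyer.BirchSwinnertonDyer.Theorems.ManinLocalTwoThree
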